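import Literature.Probability.RandomPlanarGeometry.ConformalRestrictionLemma35
import Literature.Probability.RandomPlanarGeometry.RestrictionDensityLoewner
import HarnessLib

/-!
# `LawlerSchrammWerner2003` with [LSW] Prop. 3.3 discharged down to Loewner's slit theorem

G. F. Lawler, O. Schramm, W. Werner, *Conformal restriction: the chordal case*, J. Amer. Math.
Soc. **16** (2003) 917–955, arXiv:math/0209343 (**[LSW]**, arXiv page numbers).

Proof-only bookkeeping file, joining two developments of the tree:

* `ConformalRestrictionLemma35` / `RestrictionExponent` / `RestrictionContinuityProofs`: [LSW]
  Prop. 3.3 (1) ⇒ (3) from the two clauses of Lemma 3.5, the continuity of `F` being proved, so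
  that Prop. 3.3 rests on the density of `𝒜₀` in `𝒬₊`
  (`IsPlusHull.exists_isLSWGenerated_lswConverges`);
* `RestrictionDensityArc` / `LoewnerEulerScheme` / `RestrictionDensityLoewner`: that density from
  **Loewner's theorem for the boundary path of a smooth hull** (named fact
  `IsArcHull.exists_loewner_chain`: [LSW] p. 13 "By the chordal version of Loewner's theorem",
  Lawler (2005) Prop. 4.4), via `IsPlusHull.exists_isLSWGenerated_lswConverges_of_loewner`.

Hence:

* `exists_isRestrictionMeasure_of_isHullMultiplicative_of_loewner` — **[LSW] Prop. 3.3 (1) ⇒ (3)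
  holds relative to Loewner's slit theorem alone**;
* `LawlerSchrammWerner2003_of_leaf_facts''''''` — the target fact
  `Literature.Probability.RandomPlanarGeometry.LawlerSchrammWerner2003` ([LSW] p. 5 result 2,
  transposed) from NINE leaf facts: the four Rohde–Schramm / Lawler–Schramm–Werner trace
  theorems (`hasSLETrace_eight`, `hasSLETrace_of_ne_eight`, `tendsto_norm_sleTrace_atTop`,
  `ae_isSimpleTrace_sleTrace_of_le_four (κ = 8/3)`), from [LSW] §§5–6 the restriction martingale
  (`sle_exists_isRestrictionMartingale`, Prop. 5.2/5.3), Lemma 6.2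
  (`Loewner.restrictionDeriv_exitTime_gt`), Lemma 6.3 (`IsSmoothHull.restrictionDerivVanishesAtHit`),
  Loewner's slit theorem (`IsArcHull.exists_loewner_chain`), and [LSW] p. 5 result 2, first
  sentence = Thm. 7.3 / Cor. 8.6 (`IsRestrictionMeasure.eq_five_eighths_of_outer_simple`).
  Everything else in §§2–3 and §6 of [LSW] used by the target is a theorem of the tree.
-/

noncomputable section

open scoped NNReal

namespace Literature.Probability.RandomPlanarGeometry

/-- **[LSW] Proposition 3.3, (1) ⇒ (3), relative to Loewner's slit theorem**: the named fact
`exists_isRestrictionMeasure_of_isHullMultiplicative` (`RestrictionMeasures`) follows from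
`IsArcHull.exists_loewner_chain` (`RestrictionDensityLoewner`), by `RestrictionExponent` (the
assembly from Lemma 3.5), `RestrictionContinuityProofs` (continuity of `F`, proved) and
`RestrictionDensityLoewner` (density of `𝒜₀`, from Loewner's theorem).
[cite: LawlerSchrammWerner2003Restriction, Prop. 3.3 (1) ⇒ (3) (pp. 10–13)] -/
theorem exists_isRestrictionMeasure_of_isHullMultiplicative_of_loewner
    (hL : IsArcHull.exists_loewner_chain) : exists_isRestrictionMeasure_of_isHullMultiplicative :=
  exists_isRestrictionMeasure_of_isHullMultiplicative_of_lemma35 LSWConverges.tendsto_measure_avoid_holds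
    (IsPlusHull.exists_isLSWGenerated_lswConverges_of_loewner hL)

/-- **[LSW] p. 5 result 2 (transposed) from NINE leaf facts, Prop. 3.3 entering only through
Loewner's slit theorem** (`hL`); otherwise as `LawlerSchrammWerner2003_of_leaf_facts'''''`
(`ConformalRestrictionLemma35`). [cite: LawlerSchrammWerner2003Restriction, p. 5 result 2 with Prop. 3.3, Lemma 3.5, Prop. 5.2, Lemmas 6.2–6.3, Thm. 7.3, Cor. 8.6] -/
theorem LawlerSchrammWerner2003_of_leaf_facts'''''' (h8 : hasSLETrace_eight)
    (hne : hasSLETrace_of_ne_eight) (htr : tendsto_norm_sleTrace_atTop)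
    (h₆ : RandomPlanarGeometry.ae_isSimpleTrace_sleTrace_of_le_four (κ := (8 : ℝ≥0) / 3))
    (hM : sle_exists_isRestrictionMartingale) (h62 : Loewner.restrictionDeriv_exitTime_gt)
    (h63 : IsSmoothHull.restrictionDerivVanishesAtHit) (hL : IsArcHull.exists_loewner_chain)
    (h58 : IsRestrictionMeasure.eq_five_eighths_of_outer_simple) : LawlerSchrammWerner2003 :=
  LawlerSchrammWerner2003_of_leaf_facts''''' h8 hne htr h₆ hM h62 h63
    (IsPlusHull.exists_isLSWGenerated_lswConverges_of_loewner hL) h58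

end Literature.Probability.RandomPlanarGeometry

end
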